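import Literature.Algebra.Module.LoewySeries
import HarnessLib

/-!
# Length and multiplicities are additive along the Loewy series: `ℓ(M) = Σₖ ℓ(socᵏ⁺¹ M/socᵏ M) = Σₖ ℓ(radᵏ M/radᵏ⁺¹ M)`,
# `[M : S] = Σₖ [socᵏ⁺¹ M/socᵏ M : S]` (Berrick–Keating Thm. 4.1.12 (ii); Knapp–Vogan App. A §3; Krause, Conventions)

Family `hodge`, lane `lit-hodgefound` (foundations library; seat `lit-hodgefound-p39`, generation 34, row g34-#6); topic `Algebra/Module`,
namespace `Literature.Algebra.Module.SocleRadical` (continued).  Sequel of `CompositionMultiplicity` (g33-#1: `JordanHoelder.factorOf A B =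
↥B ⧸ A.comap B.subtype`, `compMult R M S = [M : S]`, **Berrick–Keating Thm. 4.1.12 (ii)** `compMult_eq_add_of_exact`/`compMult_eq_add_quotient`)
and `LoewySeries` (g33-#14: `socleSeries`, `radicalSeries`, `socleLength` = `ht`, `loewyLength` = `ℓℓ`) over an ARBITRARY ring `R`; Mathlib's
`Module.length_eq_add_of_exact` («the length of `M` is the sum of the lengths of `M′` and `M/M′`», Knapp–Vogan App. A §3 after (A.18)).  What is
formalised: the one-step additivity for a pair `A ≤ B` of submodules, **`ℓ(B) = ℓ(A) + ℓ(B/A)`** and **`[B : S] = [A : S] + [B/A : S]`**, and their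
TELESCOPED forms along both Loewy series: `ℓ(socⁿ M) = Σ_{k<n} ℓ(socᵏ⁺¹ M/socᵏ M)`, `ℓ(M) = Σ_{k<n} ℓ(radᵏ M/radᵏ⁺¹ M) + ℓ(radⁿ M)`, hence for
`M` of finite length **`ℓ(M) = Σ_{k<ht(M)} ℓ(socᵏ⁺¹ M/socᵏ M) = Σ_{k<ℓℓ(M)} ℓ(radᵏ M/radᵏ⁺¹ M)`**, and the same three statements for the
multiplicity `[· : S]` of any module `S` («mult(M) = mult(M′) + mult(M″)» summed over the Loewy layers).
Theorems only, 0 `sorry`, no definition, no named fact (net debt 0, D-0026), no instance, no notation.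

## What is formalised (any ring `R`, any `R`-modules `M`, `S`)

* §1 one step: **`length_eq_length_add_length_factorOf`** (`A ≤ B ⟹ ℓ(B) = ℓ(A) + ℓ(B/A)`), **`compMult_eq_compMult_add_compMult_factorOf`**
  (`[B : S] = [A : S] + [B/A : S]`, `B` of finite length).
* §2 socle series: `length_socleSeries_eq_sum`, **`length_eq_sum_length_socleLayers`** (finite length), `compMult_socleSeries_eq_sum`,
  **`compMult_eq_sum_compMult_socleLayers`**.
* §3 radical series: `length_eq_sum_add_length_radicalSeries`, **`length_eq_sum_length_radicalLayers`** (finite length),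
  `compMult_eq_sum_add_compMult_radicalSeries`, **`compMult_eq_sum_compMult_radicalLayers`**.

## Mathlib / Literature search

Mathlib: `Module.length_eq_add_of_exact`, `LinearMap.exact_subtype_mkQ`, `LinearEquiv.length_eq`, `Module.length_bot`, `Module.length_top`,
`Submodule.comapSubtypeEquivOfLe`, `Submodule.topEquiv`, `Finset.sum_range_succ`; Literature: g33-#1 `compMult_eq_add_quotient`, `compMult_congr_left`,
`compMult_of_subsingleton`, `isFiniteLength_submodule`; g33-#14 `le_socleSeries_succ`, `radicalSeries_succ_le`, `socleSeries_socleLength`,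
`radicalSeries_loewyLength`.  `rg -n 'length_eq_sum_length_socle|compMult_eq_sum_compMult'` over `Literature` → nothing before this file
(g33-#7 `length_eq_sum_compMult` sums over ISOMORPHISM TYPES of factors, not over Loewy layers).

## References

* A. J. Berrick, M. E. Keating, *An Introduction to Rings and Modules*, CUP (2000), Thm. 4.1.12 (ii), §4.1.13. [BerrickKeating2000]
* A. W. Knapp, D. A. Vogan, *Cohomological Induction and Unitary Representations* (1995), App. A §3 (A.18), Cor. A.27. [KnappVogan1995]
* H. Krause, *Homological Theory of Representations*, CUP (2021), Conventions and Notations (p. xxiv); §11.2 (p. 360). [Krause2021]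
* F. W. Anderson, K. R. Fuller, *Rings and Categories of Modules*, 2nd ed. (1992), §32 (p. 346). [AndersonFuller1992]
-/

open Submodule

namespace Literature.Algebra.Module

namespace SocleRadical

variable {R : Type*} [Ring R] {M : Type*} [AddCommGroup M] [Module R M]
  (S : Type*) [AddCommGroup S] [Module R S]

/-! ## §1 One step: `ℓ(B) = ℓ(A) + ℓ(B/A)`, `[B : S] = [A : S] + [B/A : S]` for `A ≤ B` -/

/-- **`ℓ(B) = ℓ(A) + ℓ(B/A)` for submodules `A ≤ B`** («the length of `M` is the sum of the lengths of `M′` and `M/M′`», applied to `A ≤ B`;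
`B/A` on the Jordan–Hölder carrier `JordanHoelder.factorOf A B`). [cite: KnappVogan1995, App. A §3 (A.18)] [cite: BerrickKeating2000, Thm. 4.1.12] -/
theorem length_eq_length_add_length_factorOf {A B : Submodule R M} (h : A ≤ B) :
    Module.length R B = Module.length R A + Module.length R (JordanHoelder.factorOf A B) := by
  rw [← (Submodule.comapSubtypeEquivOfLe h).length_eq]
  exact Module.length_eq_add_of_exact _ _ (Submodule.injective_subtype _) (Submodule.mkQ_surjective _)
    (LinearMap.exact_subtype_mkQ _)

/-- **`[B : S] = [A : S] + [B/A : S]` for submodules `A ≤ B`, `B` of finite length** («mult(M) = mult(M′) + mult(M″)»).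
[cite: BerrickKeating2000, Thm. 4.1.12 (ii)] [cite: KnappVogan1995, App. A §4 (A.30)] -/
theorem compMult_eq_compMult_add_compMult_factorOf {A B : Submodule R M} (hB : IsFiniteLength R B) (h : A ≤ B) :
    JordanHoelder.compMult R B S = JordanHoelder.compMult R A S + JordanHoelder.compMult R (JordanHoelder.factorOf A B) S := by
  rw [← JordanHoelder.compMult_congr_left S (Submodule.comapSubtypeEquivOfLe h)]
  exact JordanHoelder.compMult_eq_add_quotient S hB _

/-! ## §2 Along the socle series -/

variable (R M) in
/-- `ℓ(socⁿ M) = Σ_{k<n} ℓ(socᵏ⁺¹ M/socᵏ M)` (every module; telescoping §1 along `0 = soc⁰ ≤ soc¹ ≤ ⋯`). [cite: KnappVogan1995, App. A §3 (A.18)]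
[cite: Krause2021, Conventions «Socle»] -/
theorem length_socleSeries_eq_sum (n : ℕ) :
    Module.length R ↥(socleSeries R M n) =
      ∑ k ∈ Finset.range n, Module.length R (JordanHoelder.factorOf (socleSeries R M k) (socleSeries R M (k + 1))) := by
  induction n with
  | zero => rw [Finset.sum_range_zero, socleSeries_zero, Module.length_bot]
  | succ n ih => rw [Finset.sum_range_succ, ← ih, length_eq_length_add_length_factorOf (le_socleSeries_succ R M n)]

variable (R M) in
/-- **`ℓ(M) = Σ_{k<ht(M)} ℓ(socᵏ⁺¹ M/socᵏ M)` for `M` of finite length**: the composition length is the sum of the lengths of the Loewy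
layers of the socle series. [cite: KnappVogan1995, App. A §3 (A.18)] [cite: Krause2021, Conventions «Socle»; §11.2 (p. 360)]
[cite: AndersonFuller1992, §32 (p. 346)] -/
theorem length_eq_sum_length_socleLayers [IsArtinian R M] [IsNoetherian R M] :
    Module.length R M =
      ∑ k ∈ Finset.range (socleLength R M), Module.length R (JordanHoelder.factorOf (socleSeries R M k) (socleSeries R M (k + 1))) := by
  rw [← length_socleSeries_eq_sum, socleSeries_socleLength, Module.length_top]

/-- `[socⁿ M : S] = Σ_{k<n} [socᵏ⁺¹ M/socᵏ M : S]` for `M` of finite length. [cite: BerrickKeating2000, Thm. 4.1.12 (ii), §4.1.13]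
[cite: Krause2021, Conventions «Socle»] -/
theorem compMult_socleSeries_eq_sum (hM : IsFiniteLength R M) (n : ℕ) :
    JordanHoelder.compMult R ↥(socleSeries R M n) S =
      ∑ k ∈ Finset.range n, JordanHoelder.compMult R (JordanHoelder.factorOf (socleSeries R M k) (socleSeries R M (k + 1))) S := by
  induction n with
  | zero =>
    rw [Finset.sum_range_zero, socleSeries_zero]
    exact JordanHoelder.compMult_of_subsingleton S
  | succ n ih =>
    rw [Finset.sum_range_succ, ← ih]
    exact compMult_eq_compMult_add_compMult_factorOf S (JordanHoelder.isFiniteLength_submodule _ hM) (le_socleSeries_succ R M n)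

/-- **`[M : S] = Σ_{k<ht(M)} [socᵏ⁺¹ M/socᵏ M : S]` for `M` of finite length**: the multiplicity of `S` in `M` is the sum of its multiplicities
in the Loewy layers. [cite: BerrickKeating2000, Thm. 4.1.12 (ii), §4.1.13] [cite: Krause2021, Conventions «Socle»] [cite: AndersonFuller1992, §32 (p. 346)] -/
theorem compMult_eq_sum_compMult_socleLayers (hM : IsFiniteLength R M) :
    JordanHoelder.compMult R M S =
      ∑ k ∈ Finset.range (socleLength R M),
        JordanHoelder.compMult R (JordanHoelder.factorOf (socleSeries R M k) (socleSeries R M (k + 1))) S := by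
  obtain ⟨_, _⟩ := isFiniteLength_iff_isNoetherian_isArtinian.mp hM
  rw [← compMult_socleSeries_eq_sum S hM, socleSeries_socleLength]
  exact (JordanHoelder.compMult_congr_left S (Submodule.topEquiv (R := R) (M := M))).symm

/-! ## §3 Along the radical series -/

variable (R M) in
/-- `ℓ(M) = Σ_{k<n} ℓ(radᵏ M/radᵏ⁺¹ M) + ℓ(radⁿ M)` (every module; telescoping §1 along `M = rad⁰ ≥ rad¹ ≥ ⋯`). [cite: KnappVogan1995, App. A §3 (A.18)]
[cite: Krause2021, Conventions «Radical»] -/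
theorem length_eq_sum_add_length_radicalSeries (n : ℕ) :
    Module.length R M =
      (∑ k ∈ Finset.range n, Module.length R (JordanHoelder.factorOf (radicalSeries R M (k + 1)) (radicalSeries R M k))) +
        Module.length R ↥(radicalSeries R M n) := by
  induction n with
  | zero => rw [Finset.sum_range_zero, radicalSeries_zero, Module.length_top, zero_add]
  | succ n ih =>
    rw [Finset.sum_range_succ, ih, length_eq_length_add_length_factorOf (radicalSeries_succ_le R M n), add_assoc,
      add_comm (Module.length R ↥(radicalSeries R M (n + 1)))]

variable (R M) in
/-- **`ℓ(M) = Σ_{k<ℓℓ(M)} ℓ(radᵏ M/radᵏ⁺¹ M)` for `M` of finite length**: the composition length is the sum of the lengths of the Loewy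
layers of the radical series. [cite: KnappVogan1995, App. A §3 (A.18)] [cite: Krause2021, Conventions «Radical»; §11.2 (p. 360)]
[cite: AndersonFuller1992, §32 (p. 346)] -/
theorem length_eq_sum_length_radicalLayers [IsArtinian R M] [IsNoetherian R M] :
    Module.length R M =
      ∑ k ∈ Finset.range (loewyLength R M),
        Module.length R (JordanHoelder.factorOf (radicalSeries R M (k + 1)) (radicalSeries R M k)) := by
  rw [length_eq_sum_add_length_radicalSeries R M (loewyLength R M), radicalSeries_loewyLength, Module.length_bot, add_zero]

/-- `[M : S] = Σ_{k<n} [radᵏ M/radᵏ⁺¹ M : S] + [radⁿ M : S]` for `M` of finite length. [cite: BerrickKeating2000, Thm. 4.1.12 (ii), §4.1.13]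
[cite: Krause2021, Conventions «Radical»] -/
theorem compMult_eq_sum_add_compMult_radicalSeries (hM : IsFiniteLength R M) (n : ℕ) :
    JordanHoelder.compMult R M S =
      (∑ k ∈ Finset.range n, JordanHoelder.compMult R (JordanHoelder.factorOf (radicalSeries R M (k + 1)) (radicalSeries R M k)) S) +
        JordanHoelder.compMult R ↥(radicalSeries R M n) S := by
  induction n with
  | zero =>
    rw [Finset.sum_range_zero, radicalSeries_zero, zero_add]
    exact JordanHoelder.compMult_congr_left S (Submodule.topEquiv (R := R) (M := M)).symm
  | succ n ih =>
    rw [Finset.sum_range_succ, ih, compMult_eq_compMult_add_compMult_factorOf S (JordanHoelder.isFiniteLength_submodule _ hM)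
      (radicalSeries_succ_le R M n), add_assoc, add_comm (JordanHoelder.compMult R ↥(radicalSeries R M (n + 1)) S)]

/-- **`[M : S] = Σ_{k<ℓℓ(M)} [radᵏ M/radᵏ⁺¹ M : S]` for `M` of finite length.** [cite: BerrickKeating2000, Thm. 4.1.12 (ii), §4.1.13]
[cite: Krause2021, Conventions «Radical»] [cite: AndersonFuller1992, §32 (p. 346)] -/
theorem compMult_eq_sum_compMult_radicalLayers (hM : IsFiniteLength R M) :
    JordanHoelder.compMult R M S =
      ∑ k ∈ Finset.range (loewyLength R M),
        JordanHoelder.compMult R (JordanHoelder.factorOf (radicalSeries R M (k + 1)) (radicalSeries R M k)) S := by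
  obtain ⟨_, _⟩ := isFiniteLength_iff_isNoetherian_isArtinian.mp hM
  rw [compMult_eq_sum_add_compMult_radicalSeries S hM (loewyLength R M), radicalSeries_loewyLength]
  rw [JordanHoelder.compMult_of_subsingleton S, add_zero]

end SocleRadical

end Literature.Algebra.Module
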